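import Mathlib
import HarnessLib
import Literature.Combinatorics.Additive.StepBeyondKempermanFiniteCase
import Literature.Combinatorics.Additive.StepBeyondKempermanDescent

/-!
# Grynkiewicz 2009, Theorem 4.1 for the integers (CASE II at `G = ℤ`)

[cite: Grynkiewicz2009, Thm 4.1 (p. 10); §6 CASE II (pp. 34–35)] [tag: critical-pair] [tag: inverse-theorem]

Topic `Literature/Combinatorics/Additive`.  Cell `mm-stpp` (D-0046), seat `mm-stpp-lit` (gen 26); the port of
D. J. Grynkiewicz, *A step beyond Kemperman's structure theorem*, Mathematika **55** (2009) 67–114, concluded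
for the one infinite group every consumer of the torsion-free inverse theorems of this directory uses: `G = ℤ`.

**Theorem 4.1 (first part), for `G = ℤ`** (`Grynkiewicz2009.conclusion_int`).  Let `A, B ⊆ ℤ` be finite and
nonempty with `|A + B| = |A| + |B|`.  Then either there exist `α, β ∈ ℤ` with
(17) `|(A ∪ {α}) + (B ∪ {β})| = |A ∪ {α}| + |B ∪ {β}| − 1`, or there exist quasi-periodic decompositions
`A = A₁ ∪ A₀`, `B = B₁ ∪ B₀` with common quasi-period `H` as in Theorem 4.1 (the structure
`IsGrynkiewiczDecomp` of `StepBeyondKempermanTypes.lean`).  (In `ℤ` every nonempty finite set is aperiodic,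
so the hypothesis «`A + B` aperiodic» of the print is automatic — private `addStab_eq_singleton_zero_int` — and the
second part of Theorem 4.1 is void; in the second alternative the quasi-period is necessarily `H = ℤ` with
`A₁ = B₁ = ∅`, and the pair is of type (V) or (VI).)

PROOF = the print's CASE II (p. 34: «Assume `G` is infinite … `G ≅ ℤ^l × T` … Let `p` be a prime such that
`p > 4(M + |T| + |A||B|)`.  Let `ϕ : ℤ^l × T → (ℤ/pℤ)^l × T` be the map defined by reducing all non-torsion
coordinates modulo `p` … `ϕ` is a Freiman isomorphism … Hence `|ϕ(A + B)| = |ϕ(A)| + |ϕ(B)| = |A| + |B|`.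
Thus, since `ϕ(G)` is finite, it follows that we can apply Theorem 4.1 to `ϕ(A)` and `ϕ(B)`» … p. 35 «it
follows that (17) holds for `(A, B)`, completing the proof») AT `l = 1`, `T = 0`, run on top of the kernel
theorem for finite groups `Grynkiewicz2009.conclusion_of_finite` (`StepBeyondKempermanFiniteCase.lean`) and the
descent lemmas of `StepBeyondKempermanDescent.lean`:
* `min(|A|, |B|) = 1` is impossible and `min(|A|, |B|) = 2` is §6 Claim 3
  (`isGrynkiewiczDecomp_top_of_card_eq_two`, type (V) with group `ℤ`); `|A| = |B| = 3` is §6 Claim 6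
  (`conclusion_of_card_eq_three`), whose hypotheses «aperiodic, not quasi-periodic» hold for every finite
  subset of `ℤ` (`not_isQuasiPeriodic_int`);
* otherwise translate so that `0 = min A = min B` (the print's «By translation, we can assume all non-torsion
  coordinates … are non-negative»; invariance `seventeen_of_vadd` / `exists_isGrynkiewiczDecomp_of_vadd`), let
  `M = max(max A, max B)`, take a prime `p > 6M + |A| + |B| + 12`, and `φ = Int.castAddHom (ℤ/pℤ)`; `φ` is
  injective on every set of integers of diameter `< p` (`injOn_intCast_of_sub_lt`), in particular on the box
  `(A + B − B) + (A + B − A) ⊆ [−2M, 4M]` — this is the Freiman-isomorphism property of the print; so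
  `|φ(A) + φ(B)| = |φ(A)| + |φ(B)|` (`card_image_add_eq`) and `φ(A + B)` is aperiodic
  (`addStab_image_eq_singleton`); apply `conclusion_of_finite` in `ℤ/pℤ`;
* the first alternative (17) for `(φ(A), φ(B))` descends to `(A, B)` by `seventeen_of_seventeen_image`;
* the second alternative is IMPOSSIBLE in `ℤ/pℤ` for `p` this large (`not_isGrynkiewiczDecomp_zmod`): the
  quasi-period `K ≠ ⊥` of a group of prime order is the whole group (the print's «any element outside `T` has
  … order at least `p`», here `T = 0`), so the periodic parts are empty (a nonempty `ℤ/pℤ`-periodic set is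
  everything, of size `p > |A|`) and `(φ(A), φ(B))` itself would be of type (V) (excluded: `min ≥ 3`), (VI)
  (excluded: not `|A| = |B| = 3`), (VII) (a dual of a type (VI) pair with respect to a finite `K'`; `K' ≠ ⊥`
  since it contains the difference of two elements of a `3`-set, so `K' = ℤ/pℤ` and one member of the pair is
  the complement of a translate of a `6`-set: `|A| + |B| ≥ p − 6`, excluded), or (VIII) (needs a subgroup
  with exactly `4` elements; `ℤ/pℤ` has subgroups of `1` and `p ≠ 4` elements only).
DEVIATION FROM THE PRINT (recorded): for `T = 0` the print's internal routing of CASE II (the sub-cases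
`d⊆(ϕ(A + B), 𝒫_H) ≤ 2`, `d⊆(ϕ(A), 𝒬𝒫_H) = 0`, (62), extendibility/KST, Corollary 4.3 + Lemma 5.7) collapses,
because every nontrivial `H ≤ ϕ(G) = ℤ/pℤ` IS `ϕ(G)`, of order `p > |A| + |B| + 6`: applying the finite
theorem itself to `(ϕ(A), ϕ(B))` and reading its two alternatives is all that is needed, and Corollary 4.3
(not in the tree) is not used.  The general infinite case (`l ≥ 1`, `T ≠ 0`; transport of quasi-periodicity
and of the decompositions for `H ≤ T`) is NOT proved here — see `mm-stpp-lit/calc/gen25/CASE-II-SCOPING.md`.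

WHAT THIS FILE IS NOT: no new definitions, no named facts (`def … : Prop`), no `sorry`; census-silent (the
cell's hosts are finite); nothing about ω.

## Main statements
* (private, [folklore]) `addStab_eq_singleton_zero_int`, `not_isQuasiPeriodic_int` — finite subsets of `ℤ` are
  aperiodic and not quasi-periodic; `addSubgroup_zmod_eq_bot_or_eq_top`, `eq_univ_of_isPeriodicWith_top`;
* `Grynkiewicz2009.injOn_intCast_of_sub_lt` — reduction mod `p` is injective on a set of diameter `< p`
  (the Freiman-isomorphism step of CASE II) [cite: Grynkiewicz2009, §6 CASE II (p. 34)];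
* `Grynkiewicz2009.not_isQuasiPeriodic_zmod`, `Grynkiewicz2009.not_isGrynkiewiczDecomp_zmod` — in `ℤ/pℤ`
  with `p > |A| + |B| + 6`, `min(|A|,|B|) ≥ 3` and not `|A| = |B| = 3`, the second alternative of Theorem 4.1
  cannot occur [cite: Grynkiewicz2009, §6 CASE II (pp. 34–35), §4 (types (V)–(VIII))];
* **`Grynkiewicz2009.conclusion_int`** — Theorem 4.1 (first part) for `G = ℤ`
  [cite: Grynkiewicz2009, Thm 4.1; §6 CASE II].

## References
* D. J. Grynkiewicz, *A step beyond Kemperman's structure theorem*, Mathematika 55 (2009) 67–114,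
  doi:10.1112/S0025579300000966 — Theorem 4.1 p. 10; §6 CASE II pp. 34–35 (read 2026-08-29 in the held text
  `paper:doi-10-1112-s0025579300000966`, p0034 L20–L33, p0035 L19–L25). [cite: Grynkiewicz2009, Thm 4.1]
-/

namespace Literature.Combinatorics.Additive

open Finset
open scoped Pointwise

namespace Grynkiewicz2009

/-! ### Finite subsets of `ℤ`: aperiodic, not quasi-periodic -/

/-- In `ℤ`, a translate `h + S` of a nonempty finite set `S` equals `S` only for `h = 0` (compare the maxima
and the minima). [folklore] -/
private theorem eq_zero_of_vadd_finset_eq_int {S : Finset ℤ} (hS : S.Nonempty) {h : ℤ} (hper : h +ᵥ S = S) :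
    h = 0 := by
  have h1 : h + S.max' hS ∈ S := by
    have : h +ᵥ S.max' hS ∈ h +ᵥ S := vadd_mem_vadd_finset (max'_mem S hS)
    rwa [hper, vadd_eq_add] at this
  have h2 : h + S.min' hS ∈ S := by
    have : h +ᵥ S.min' hS ∈ h +ᵥ S := vadd_mem_vadd_finset (min'_mem S hS)
    rwa [hper, vadd_eq_add] at this
  have := le_max' S _ h1
  have := min'_le S _ h2
  omega

/-- A nonempty finite subset of `ℤ` is aperiodic: its stabilizer is `{0}`. [folklore] -/
private theorem addStab_eq_singleton_zero_int {S : Finset ℤ} (hS : S.Nonempty) : S.addStab = {0} := by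
  ext h
  rw [mem_singleton, mem_addStab hS]
  refine ⟨eq_zero_of_vadd_finset_eq_int hS, ?_⟩
  rintro rfl
  exact zero_vadd ℤ S

/-- A finite subset of `ℤ` is not quasi-periodic (a nonempty `H`-periodic finite set needs `H` finite, and
`ℤ` has no nontrivial finite subgroup). [folklore] -/
private theorem not_isQuasiPeriodic_int (A : Finset ℤ) : ¬ IsQuasiPeriodic A := by
  rintro ⟨H, A₁, A₀, hd, hne⟩
  obtain ⟨h, hh, hh0⟩ : ∃ h ∈ H, h ≠ 0 := by
    rcases H.bot_or_exists_ne_zero with hbot | hex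
    · exact absurd hbot hd.ne_bot
    · exact hex
  exact hh0 (eq_zero_of_vadd_finset_eq_int hne (hd.periodic h hh))

/-- `ℤ` is not the trivial group: `⊤ ≠ ⊥` in `AddSubgroup ℤ`. [folklore] -/
private theorem top_ne_bot_int : (⊤ : AddSubgroup ℤ) ≠ ⊥ := by
  intro h
  have h1 : (1 : ℤ) ∈ (⊤ : AddSubgroup ℤ) := AddSubgroup.mem_top 1
  rw [h, AddSubgroup.mem_bot] at h1
  exact one_ne_zero h1

/-! ### Reduction modulo a large prime is a Freiman isomorphism on a box -/

/-- Reduction mod `p` is injective on any set of integers whose pairwise differences are `< p` in absolute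
value — the Freiman-isomorphism property used in CASE II («Since `p > … ≥ 2M`, it follows that `ϕ` is a
Freiman isomorphism»). [cite: Grynkiewicz2009, §6 CASE II (p. 34)] -/
theorem injOn_intCast_of_sub_lt (p : ℕ) {T : Set ℤ} (hT : ∀ x ∈ T, ∀ y ∈ T, |y - x| < p) :
    Set.InjOn (Int.castAddHom (ZMod p) : ℤ → ZMod p) T := by
  intro x hx y hy hxy
  have hdvd : (p : ℤ) ∣ y - x := (ZMod.intCast_eq_intCast_iff_dvd_sub x y p).1 hxy
  have h0 : y - x = 0 := Int.eq_zero_of_abs_lt_dvd hdvd (hT x hx y hy)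
  omega

/-! ### In `ℤ/pℤ` with `p` large the second alternative of Theorem 4.1 is impossible -/

section ZModP

variable {p : ℕ} [hp : Fact p.Prime]

/-- `|ℤ/pℤ| = p` is prime, as a `Fact` about `Nat.card`. [folklore] -/
private theorem natCard_zmod_prime : Fact (Nat.card (ZMod p)).Prime := by
  rw [Nat.card_eq_fintype_card, ZMod.card]; exact hp

/-- A subgroup of `ℤ/pℤ` is `⊥` or `⊤`. [folklore] -/
private theorem addSubgroup_zmod_eq_bot_or_eq_top (H : AddSubgroup (ZMod p)) : H = ⊥ ∨ H = ⊤ :=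
  haveI := natCard_zmod_prime (p := p)
  H.eq_bot_or_eq_top_of_prime_card

/-- A nonempty `⊤`-periodic finite set is everything. [folklore] -/
private theorem eq_univ_of_isPeriodicWith_top {G : Type*} [AddCommGroup G] [DecidableEq G] [Fintype G]
    {S : Finset G} (hS : IsPeriodicWith ⊤ S) (hne : S.Nonempty) : S = univ := by
  obtain ⟨s, hs⟩ := hne
  refine eq_univ_of_forall fun g => ?_
  have : (g - s) +ᵥ S = S := hS (g - s) (AddSubgroup.mem_top _)
  rw [← this]
  exact mem_vadd_finset.2 ⟨s, hs, by rw [vadd_eq_add, sub_add_cancel]⟩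

/-- In `ℤ/pℤ` a set with fewer than `p` elements is not quasi-periodic.
[cite: Grynkiewicz2009, §6 CASE II (p. 34, «`|ϕ(A)| = |A| ≥ |H|` … a contradiction»)] -/
theorem not_isQuasiPeriodic_zmod {X : Finset (ZMod p)} (hX : #X < p) : ¬ IsQuasiPeriodic X := by
  rintro ⟨H, X₁, X₀, hd, hne⟩
  rcases addSubgroup_zmod_eq_bot_or_eq_top H with hbot | htop
  · exact hd.ne_bot hbot
  · subst htop
    have hX₁ : X₁ = univ := eq_univ_of_isPeriodicWith_top hd.periodic hne
    have hsub : X₁ ⊆ X := by rw [← hd.union_eq]; exact subset_union_left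
    have := card_le_card hsub
    rw [hX₁, card_univ, ZMod.card] at this
    omega

/-- A finset that is the carrier of a subgroup of `ℤ/pℤ` has `1` or `p` elements. [folklore] -/
private theorem card_carrier_zmod {K : AddSubgroup (ZMod p)} {Kf : Finset (ZMod p)}
    (hKf : ∀ g, g ∈ Kf ↔ g ∈ K) : #Kf = 1 ∨ #Kf = p := by
  rcases addSubgroup_zmod_eq_bot_or_eq_top K with hbot | htop
  · left
    subst hbot
    have : Kf = {0} := by
      ext g; rw [hKf, AddSubgroup.mem_bot, mem_singleton]
    rw [this, card_singleton]
  · right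
    subst htop
    have : Kf = univ := eq_univ_of_forall fun g => (hKf g).2 (AddSubgroup.mem_top g)
    rw [this, card_univ, ZMod.card]

/-- **The second alternative of Theorem 4.1 cannot occur in `ℤ/pℤ` for `p > |X| + |Y| + 6` when
`|X|, |Y| ≥ 3` and not `|X| = |Y| = 3`.**  (The quasi-period is `⊤`, the periodic parts are empty, and each
of the types (V)–(VIII) for `(X, Y)` is excluded by size, by `p ∤ 4`, or — type (VII) — because one member
would be the complement of a translate of a `6`-set.)
[cite: Grynkiewicz2009, §6 CASE II (pp. 34–35); §4 (types (V)–(VIII), p. 10)] -/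
theorem not_isGrynkiewiczDecomp_zmod {X Y : Finset (ZMod p)} (hX3 : 3 ≤ #X) (hY3 : 3 ≤ #Y)
    (h33 : ¬ (#X = 3 ∧ #Y = 3)) (hpXY : #X + #Y + 6 < p)
    {K : AddSubgroup (ZMod p)} {X₁ X₀ Y₁ Y₀ : Finset (ZMod p)}
    (hD : IsGrynkiewiczDecomp K X Y X₁ X₀ Y₁ Y₀) : False := by
  classical
  obtain ⟨-, hX₀⟩ := hD.decomp_left.left_eq_empty_of_not_isQuasiPeriodic
    (not_isQuasiPeriodic_zmod (by omega))
  obtain ⟨-, hY₀⟩ := hD.decomp_right.left_eq_empty_of_not_isQuasiPeriodic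
    (not_isQuasiPeriodic_zmod (by omega))
  have hbot := hD.bottom
  rw [hX₀, hY₀] at hbot
  rcases hbot with hV | hVI | hVII | hVIII
  · have := hV.1
    rcases le_total #X #Y with h | h
    · rw [min_eq_left h] at this; omega
    · rw [min_eq_right h] at this; omega
  · exact h33 ⟨hVI.1, hVI.2.1⟩
  · obtain ⟨K', A', B', -, hVI', hdual⟩ := hVII
    have hA'3 : #A' = 3 := hVI'.1
    have hB'3 : #B' = 3 := hVI'.2.1
    have h6 : #(A' + B') = 6 := by rw [hVI'.card_add, hA'3, hB'3]
    obtain ⟨a, ha, b, hb, hAK, hBK, -, -, hcases⟩ := hdual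
    -- `K' ≠ ⊥`: `A'` has an element other than `a`, and its difference with `a` lies in `K'`
    have hK'top : K' = ⊤ := by
      rcases addSubgroup_zmod_eq_bot_or_eq_top K' with hbot | htop
      · exfalso
        subst hbot
        have hsub : A' ⊆ {a} := fun x hx => by
          have := hAK x hx
          rw [AddSubgroup.mem_bot, sub_eq_zero] at this
          rw [mem_singleton, this]
        have := card_le_card hsub
        rw [card_singleton] at this
        omega
      · exact htop
    subst hK'top
    -- one member of `(X, Y)` is `g' + (A' + B')ᶜ`, of size `p − 6`
    have key : ∀ {Z : Finset (ZMod p)} {g' c : ZMod p},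
        (∀ z, z ∈ Z ↔ (z - g') - c ∈ (⊤ : AddSubgroup (ZMod p)) ∧ z - g' ∉ A' + B') →
        #Z = p - 6 := by
      intro Z g' c hiff
      have hZ : Z = g' +ᵥ (A' + B')ᶜ := by
        ext z
        rw [hiff z, mem_vadd_finset]
        constructor
        · rintro ⟨-, hz⟩
          exact ⟨z - g', mem_compl.2 hz, by rw [vadd_eq_add]; abel⟩
        · rintro ⟨y, hy, rfl⟩
          refine ⟨AddSubgroup.mem_top _, ?_⟩
          rw [vadd_eq_add, add_sub_cancel_left]
          exact mem_compl.1 hy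
      rw [hZ, card_vadd_finset, card_compl, h6, ZMod.card]
    rcases hcases with ⟨g, g', -, hYiff⟩ | ⟨g, g', -, hXiff⟩
    · have := key hYiff
      omega
    · have := key hXiff
      omega
  · obtain ⟨-, -, -, K', Kf, hKf, hK4, -⟩ := hVIII
    rcases card_carrier_zmod hKf with h1 | hP
    · omega
    · -- `p = 4` is not prime
      have h4 : p = 4 := by omega
      exact absurd hp.out (by rw [h4]; decide)

end ZModP

/-! ### Theorem 4.1 for `G = ℤ` -/

/-- `(g + A) + (g' + B) = (g + g') + (A + B)` (a copy of the private lemma of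
`StepBeyondKempermanTypes.lean`). [folklore] -/
private theorem vadd_add_vadd_int (A B : Finset ℤ) (g g' : ℤ) :
    (g +ᵥ A) + (g' +ᵥ B) = (g + g') +ᵥ (A + B) := by
  rw [vadd_add_assoc, add_comm A (g' +ᵥ B), vadd_add_assoc, vadd_vadd, add_comm B A]

/-- `|A| ≥ 2` when `|A + B| = |A| + |B|` with `B ≠ ∅` (§6 Claim 3, first sentence: «If `|A| = 1`, then
`|A + B| = |A| + |B|` cannot hold»). [cite: Grynkiewicz2009, §6 Claim 3 (p. 24)] -/
private theorem two_le_card_left_int {A B : Finset ℤ} (hA : A.Nonempty) (hB : B.Nonempty)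
    (hAB : #(A + B) = #A + #B) : 2 ≤ #A := by
  by_contra h
  have h1 : #A = 1 := by have := hA.card_pos; omega
  obtain ⟨a, rfl⟩ := card_eq_one.1 h1
  rw [singleton_add, card_vadd_finset, card_singleton] at hAB
  have := hB.card_pos
  omega

/-- The box bound behind the Freiman isomorphism: if `A', B' ⊆ [0, M]` then every element of
`(A' + B' − B') + (A' + B' − A')` and of `(A' + B') + ((A' + B') − (A' + B'))` lies in `[−2M, 4M]`.
[cite: Grynkiewicz2009, §6 CASE II (p. 34, «`p > … ≥ 2M`»)] -/
private theorem abs_sub_lt_of_mem_box {A' B' : Finset ℤ} {M : ℤ} {p : ℕ}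
    (hA : ∀ x ∈ A', 0 ≤ x ∧ x ≤ M) (hB : ∀ y ∈ B', 0 ≤ y ∧ y ≤ M) (hp : 6 * M < p) :
    (∀ x ∈ ((A' + B' - B') + (A' + B' - A') : Finset ℤ), ∀ y ∈ ((A' + B' - B') + (A' + B' - A') : Finset ℤ),
      |y - x| < p) ∧
    (∀ x ∈ ((A' + B') + ((A' + B') - (A' + B')) : Finset ℤ),
      ∀ y ∈ ((A' + B') + ((A' + B') - (A' + B')) : Finset ℤ), |y - x| < p) := by
  have box1 : ∀ x ∈ ((A' + B' - B') + (A' + B' - A') : Finset ℤ), -(2 * M) ≤ x ∧ x ≤ 4 * M := by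
    intro x hx
    obtain ⟨u, hu, v, hv, rfl⟩ := mem_add.1 hx
    obtain ⟨s, hs, b, hb, rfl⟩ := mem_sub.1 hu
    obtain ⟨a₁, ha₁, b₁, hb₁, rfl⟩ := mem_add.1 hs
    obtain ⟨s', hs', a, ha, rfl⟩ := mem_sub.1 hv
    obtain ⟨a₂, ha₂, b₂, hb₂, rfl⟩ := mem_add.1 hs'
    have := hA a₁ ha₁; have := hA a₂ ha₂; have := hA a ha
    have := hB b₁ hb₁; have := hB b₂ hb₂; have := hB b hb
    constructor <;> omega
  have box2 : ∀ x ∈ ((A' + B') + ((A' + B') - (A' + B')) : Finset ℤ), -(2 * M) ≤ x ∧ x ≤ 4 * M := by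
    intro x hx
    obtain ⟨u, hu, v, hv, rfl⟩ := mem_add.1 hx
    obtain ⟨a₁, ha₁, b₁, hb₁, rfl⟩ := mem_add.1 hu
    obtain ⟨s, hs, s', hs', rfl⟩ := mem_sub.1 hv
    obtain ⟨a₂, ha₂, b₂, hb₂, rfl⟩ := mem_add.1 hs
    obtain ⟨a₃, ha₃, b₃, hb₃, rfl⟩ := mem_add.1 hs'
    have := hA a₁ ha₁; have := hA a₂ ha₂; have := hA a₃ ha₃
    have := hB b₁ hb₁; have := hB b₂ hb₂; have := hB b₃ hb₃
    constructor <;> omega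
  constructor
  · intro x hx y hy
    have := box1 x hx; have := box1 y hy
    rw [abs_sub_lt_iff]; constructor <;> omega
  · intro x hx y hy
    have := box2 x hx; have := box2 y hy
    rw [abs_sub_lt_iff]; constructor <;> omega

/-- **Grynkiewicz 2009, Theorem 4.1 (first part) for `G = ℤ`.**  Let `A, B ⊆ ℤ` be finite and nonempty
with `|A + B| = |A| + |B|`.  Then either (17) `|(A ∪ {α}) + (B ∪ {β})| = |A ∪ {α}| + |B ∪ {β}| − 1` for
some `α, β ∈ ℤ`, or `A`, `B` admit the quasi-periodic decompositions of Theorem 4.1 (necessarily with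
quasi-period `ℤ`, empty periodic parts, and `(A, B)` of type (V) or (VI)).  The aperiodicity hypothesis of
the print is automatic in `ℤ` (`addStab_eq_singleton_zero_int`).  Proof: the print's CASE II at
`G ≅ ℤ¹ × 0` on top of `conclusion_of_finite` — see the module docstring.
[cite: Grynkiewicz2009, Thm 4.1 (p. 10); §6 CASE II (pp. 34–35)] -/
theorem conclusion_int {A B : Finset ℤ} (hA : A.Nonempty) (hB : B.Nonempty)
    (hAB : #(A + B) = #A + #B) :
    (∃ α β : ℤ, #(insert α A + insert β B) + 1 = #(insert α A) + #(insert β B)) ∨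
      ∃ (K : AddSubgroup ℤ) (A₁ A₀ B₁ B₀ : Finset ℤ), IsGrynkiewiczDecomp K A B A₁ A₀ B₁ B₀ := by
  classical
  -- `|A|, |B| ≥ 2`; `|A| = 2` or `|B| = 2` is Claim 3 (type (V), quasi-period `ℤ`)
  have hA2 : 2 ≤ #A := two_le_card_left_int hA hB hAB
  have hB2 : 2 ≤ #B := by
    have hBA : #(B + A) = #B + #A := by rw [add_comm, hAB, add_comm]
    exact two_le_card_left_int hB hA hBA
  rcases eq_or_lt_of_le hA2 with hA2' | hA3
  · exact Or.inr ⟨⊤, ∅, A, ∅, B, isGrynkiewiczDecomp_top_of_card_eq_two top_ne_bot_int hA2'.symm hAB⟩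
  rcases eq_or_lt_of_le hB2 with hB2' | hB3
  · exact Or.inr ⟨⊤, ∅, A, ∅, B, isGrynkiewiczDecomp_top_of_card_eq_two' top_ne_bot_int hB2'.symm hAB⟩
  -- `|A| = |B| = 3` is Claim 6
  by_cases h33 : #A = 3 ∧ #B = 3
  · exact conclusion_of_card_eq_three h33.1 h33.2 hAB (addStab_eq_singleton_zero_int (hA.add hB))
      (not_isQuasiPeriodic_int A) (not_isQuasiPeriodic_int B)
  -- CASE II proper: translate into `[0, M]`, reduce modulo a large prime, apply the finite theorem
  obtain ⟨a₀, ha₀⟩ : ∃ a₀, a₀ = A.min' hA := ⟨_, rfl⟩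
  obtain ⟨b₀, hb₀⟩ : ∃ b₀, b₀ = B.min' hB := ⟨_, rfl⟩
  obtain ⟨A', hA'⟩ : ∃ A', A' = (-a₀) +ᵥ A := ⟨_, rfl⟩
  obtain ⟨B', hB'⟩ : ∃ B', B' = (-b₀) +ᵥ B := ⟨_, rfl⟩
  have hmemA' : ∀ x, x ∈ A' ↔ x + a₀ ∈ A := fun x => by
    rw [hA', mem_vadd_finset]
    constructor
    · rintro ⟨a, ha, rfl⟩; rw [vadd_eq_add, show -a₀ + a + a₀ = a by abel]; exact ha
    · intro hx; exact ⟨x + a₀, hx, by rw [vadd_eq_add]; abel⟩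
  have hmemB' : ∀ y, y ∈ B' ↔ y + b₀ ∈ B := fun y => by
    rw [hB', mem_vadd_finset]
    constructor
    · rintro ⟨b, hb, rfl⟩; rw [vadd_eq_add, show -b₀ + b + b₀ = b by abel]; exact hb
    · intro hy; exact ⟨y + b₀, hy, by rw [vadd_eq_add]; abel⟩
  have h0A' : (0 : ℤ) ∈ A' := (hmemA' 0).2 (by rw [zero_add, ha₀]; exact min'_mem A hA)
  have h0B' : (0 : ℤ) ∈ B' := (hmemB' 0).2 (by rw [zero_add, hb₀]; exact min'_mem B hB)
  have hA'ne : A'.Nonempty := ⟨0, h0A'⟩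
  have hB'ne : B'.Nonempty := ⟨0, h0B'⟩
  have hA'c : #A' = #A := by rw [hA', card_vadd_finset]
  have hB'c : #B' = #B := by rw [hB', card_vadd_finset]
  have hA'B' : #(A' + B') = #A' + #B' := by
    rw [hA', hB', vadd_add_vadd_int, card_vadd_finset, card_vadd_finset, card_vadd_finset, hAB]
  -- the box `[0, M]`
  obtain ⟨M, hM⟩ : ∃ M : ℤ, M = (A.max' hA - a₀) + (B.max' hB - b₀) := ⟨_, rfl⟩
  have hMA : 0 ≤ A.max' hA - a₀ := by
    have := min'_le A _ (max'_mem A hA); rw [ha₀]; omega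
  have hMB : 0 ≤ B.max' hB - b₀ := by
    have := min'_le B _ (max'_mem B hB); rw [hb₀]; omega
  have hboxA : ∀ x ∈ A', 0 ≤ x ∧ x ≤ M := fun x hx => by
    have h1 := min'_le A _ ((hmemA' x).1 hx)
    have h2 := le_max' A _ ((hmemA' x).1 hx)
    rw [← ha₀] at h1
    constructor <;> omega
  have hboxB : ∀ y ∈ B', 0 ≤ y ∧ y ≤ M := fun y hy => by
    have h1 := min'_le B _ ((hmemB' y).1 hy)
    have h2 := le_max' B _ ((hmemB' y).1 hy)
    rw [← hb₀] at h1
    constructor <;> omega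
  -- a prime `p > 6M + |A| + |B| + 12`
  obtain ⟨p, hpN, hp⟩ := Nat.exists_infinite_primes (6 * M.toNat + #A + #B + 13)
  haveI : Fact p.Prime := ⟨hp⟩
  have hM0 : 0 ≤ M := by omega
  have hpM : 6 * M < (p : ℤ) := by
    have : (M.toNat : ℤ) = M := Int.toNat_of_nonneg hM0
    omega
  obtain ⟨hbox1, hbox2⟩ := abs_sub_lt_of_mem_box hboxA hboxB hpM
  -- `φ` = reduction mod `p`, a Freiman isomorphism on the boxes
  have hinj1 : Set.InjOn (Int.castAddHom (ZMod p)) ↑((A' + B' - B') + (A' + B' - A')) :=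
    injOn_intCast_of_sub_lt p fun x hx y hy => hbox1 x hx y hy
  have hinj2 : Set.InjOn (Int.castAddHom (ZMod p)) ↑((A' + B') + ((A' + B') - (A' + B'))) :=
    injOn_intCast_of_sub_lt p fun x hx y hy => hbox2 x hx y hy
  obtain ⟨himg, hcAB, hcA, hcB⟩ := card_image_add_eq (Int.castAddHom (ZMod p)) h0A' h0B' hinj1
  have hXY : #(A'.image (Int.castAddHom (ZMod p)) + B'.image (Int.castAddHom (ZMod p))) =
      #(A'.image (Int.castAddHom (ZMod p))) + #(B'.image (Int.castAddHom (ZMod p))) := by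
    rw [himg, hcAB, hcA, hcB, hA'B']
  have haper : (A'.image (Int.castAddHom (ZMod p)) + B'.image (Int.castAddHom (ZMod p))).addStab = {0} := by
    rw [himg]
    exact addStab_image_eq_singleton _ (hA'ne.add hB'ne) hinj2
      (addStab_eq_singleton_zero_int (hA'ne.add hB'ne))
  -- apply Theorem 4.1 for the finite group `ℤ/pℤ`
  rcases conclusion_of_finite (hA'ne.image _) (hB'ne.image _) hXY haper with h17 | ⟨K, X₁, X₀, Y₁, Y₀, hD⟩
  · -- (17) descends along `φ` and is translation invariant
    have h17' := seventeen_of_seventeen_image (Int.castAddHom (ZMod p)) h0A' h0B' (by omega) (by omega)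
      hA'B' hinj1 h17
    rw [hA', hB'] at h17'
    exact Or.inl (seventeen_of_vadd h17')
  · -- the decomposition cannot occur in `ℤ/pℤ`
    exfalso
    refine not_isGrynkiewiczDecomp_zmod (by rw [hcA]; omega) (by rw [hcB]; omega)
      (by rw [hcA, hcB, hA'c, hB'c]; exact h33) ?_ hD
    rw [hcA, hcB, hA'c, hB'c]
    omega

end Grynkiewicz2009

end Literature.Combinatorics.Additive
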